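import Literature.NumberTheory.Transcendental.QuadraticRelationsLogarithmsSec5Params
import Mathlib.Analysis.Complex.Exponential
import Mathlib.Data.Nat.Choose.Basic
import HarnessLib

/-!
# Roy–Waldschmidt 1997, §5: the parameter constraints of Théorème 2.1 ("les autres contraintes étant plus ou moins immédiates")

D. Roy, M. Waldschmidt, Ann. Sci. ÉNS (4) 30 (1997) 753–796, proof of Théorème 5.1, pp. 781–783.
With the parameters `S₀ = T₀`, `T₁`, `S₁`, `S_{ℓ₁}` of p. 781 (`Sec5.T0`, `Sec5.T1`, `Sec5.S1`, `Sec5.S2`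
of `…Sec5Params.lean`) and (p. 782) `A₁ = ⋯ = A_{d₁} = exp(κD/(T₁ log κ))`,
`A'₁ = ⋯ = A'_{d₁} = exp(D/(T₁ log κ))`, `B₁ = B₂ = E = D`, `V = (4c)⁻¹κD²`, `U = (12d+13)⁻¹V`:
"On peut vérifier que, pour `κ` assez grand et pour le choix de paramètres établi ci-dessus, toutes
les hypothèses du théorème 2.1 sont remplies. … Nous allons encore vérifier les trois inégalités
concernant la hauteur, les autres contraintes étant plus ou moins immédiates", followed by the height
estimates of p. 782–783 and "Comme `d > 2n > 0` et `n ≥ d₀`, on trouve que, pour `κ` assez grand, on a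
`D^{1/(2d₁)} < T₁ < D^{1-1/(2d₁)}`" (p. 781), and for Théorème 4.1: "`D > max{2d₁∑TᵢlogA'ᵢ, 2d₀ log B₁ + ℓ₀ log B₂}`".

This file PROVES the purely numerical facts, with explicit thresholds `κ ≥ κ₁`, `D ≥ D₁(κ)` (the paper
only says "assez grand"): bounds on the parameters (`Sec5.param_bounds`: `T₀ ≍ κD/(log κ log D)`,
`D^{1/d₁}/2 ≤ T₁ ≤ D/(2(log κ)²)`, `T₁S₁ ≤ κD/(log κ)²`, `T₁S₂ ≤ D/(log κ)²`, …) and the list of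
inequalities consumed by the §5 assembly (`Sec5.U_constraints`, `Sec5.B₂_constraint`,
`Sec5.exp_constraint`, `Sec5.V_constraint`, `Sec5.logA_constraints`, `Sec5.additive_height_constraint`,
`Sec5.approx_constraints`, `Sec5.thm41_constraint`), each tagged in its statement.

No definitions, no named facts.

## References

* [RoyWaldschmidt1997ENS] D. Roy, M. Waldschmidt, Ann. Sci. ÉNS (4) 30 (1997) 753–796, proof of
  Théorème 5.1, pp. 781–783; Théorème 2.1 pp. 761–762; Théorème 4.1 p. 772.
-/

noncomputable section

open Real

namespace Literature.NumberTheory.Transcendental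

namespace RoyWaldschmidt1997

namespace Sec5

/-! ### Elementary helpers -/

/-- `M · L ≤ exp L` once `L ≥ 2M`, `M ≥ 0` (via `exp L ≥ 1 + L + L²/2`). [folklore] -/
theorem mul_le_exp_of_ge {M L : ℝ} (hM : 0 ≤ M) (hL : 2 * M ≤ L) : M * L ≤ Real.exp L := by
  have hL0 : 0 ≤ L := le_trans (by positivity) hL
  have h0 := Real.quadratic_le_exp_of_nonneg hL0
  nlinarith

/-- `C(m + d, d) ≥ (m+1)^d / d!` (from `(n+1-k)^k ≤ n^{(k)}`). [folklore] -/
theorem pow_div_factorial_le_choose (m d : ℕ) :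
    ((m : ℝ) + 1) ^ d / d.factorial ≤ (Nat.choose (m + d) d : ℝ) := by
  have h := Nat.pow_sub_le_descFactorial (m + d) d
  rw [Nat.descFactorial_eq_factorial_mul_choose, show m + d + 1 - d = m + 1 by omega] at h
  have h' : (((m + 1) ^ d : ℕ) : ℝ) ≤ ((d.factorial * (m + d).choose d : ℕ) : ℝ) := by exact_mod_cast h
  push_cast at h'
  rw [div_le_iff₀ (by positivity)]
  linarith

/-! ### Bounds on the parameters `T₀, T₁, S₁, S₂` -/

set_option maxHeartbeats 1600000 in
/-- **Parameter bounds.** For `n > 0`, `n ≥ d₀`, `d₀ + d₁ > 2n`, `d₁ > 0` there is `κ₁ ≥ e³` such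
that for `κ ≥ κ₁` there is `D₁ ≥ 3` with, for all `D ≥ D₁` (`k = log κ`, `L = log D`):
`1 ≤ T₀ ≤ κD/(kL)` and `κD/(kL) ≤ 2T₀`; `1 ≤ T₁`, `2k²T₁ ≤ D`, `D^{1/d₁} ≤ 2T₁`, `Θ ≤ (T₁+1)^{d₁}`;
`1 ≤ S₂ ≤ S₁`, `k²T₁S₁ ≤ κD`, `k²T₁S₂ ≤ D`; and `3 ≤ k ≤ κ`, `3 ≤ L`, `2(d+1)κ ≤ kL`-type
largeness `L ≥ κ`. [cite: RoyWaldschmidt1997ENS, proof of Théorème 5.1, p. 781] -/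
theorem param_bounds (d₀ d₁ n : ℕ) (hn : 0 < n) (hd₀n : d₀ ≤ n) (h2n : 2 * n < d₀ + d₁) (hd₁ : 0 < d₁)
    (k₁ : ℝ) (L₁ : ℝ → ℝ) :
    ∃ κ₁ : ℝ, Real.exp 3 ≤ κ₁ ∧ ∀ κ : ℝ, κ₁ ≤ κ → k₁ ≤ Real.log κ ∧ ∃ D₁ : ℕ, 3 ≤ D₁ ∧ ∀ D : ℕ, D₁ ≤ D →
      L₁ κ ≤ Real.log D ∧ κ ≤ Real.log D ∧ 3 ≤ Real.log κ ∧ Real.log κ ≤ κ ∧ 3 ≤ Real.log (D : ℝ) ∧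
      (1 ≤ T0 κ D ∧ (T0 κ D : ℝ) ≤ κ * D / (Real.log κ * Real.log D) ∧
        κ * D / (Real.log κ * Real.log D) ≤ 2 * T0 κ D) ∧
      (1 ≤ T1 d₀ d₁ n κ D ∧ 2 * Real.log κ ^ 2 * T1 d₀ d₁ n κ D ≤ D ∧
        (D : ℝ) ^ (1 / (d₁ : ℝ)) ≤ 2 * T1 d₀ d₁ n κ D ∧
        Theta d₀ d₁ n κ D ≤ ((T1 d₀ d₁ n κ D : ℝ) + 1) ^ d₁ ∧
        (T1 d₀ d₁ n κ D : ℝ) ^ d₁ ≤ Theta d₀ d₁ n κ D) ∧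
      (1 ≤ S2 d₀ d₁ n κ D ∧ S2 d₀ d₁ n κ D ≤ S1 d₀ d₁ n κ D ∧
        Real.log κ ^ 2 * T1 d₀ d₁ n κ D * S1 d₀ d₁ n κ D ≤ κ * D ∧
        Real.log κ ^ 2 * T1 d₀ d₁ n κ D * S2 d₀ d₁ n κ D ≤ D ∧
        (D : ℝ) ≤ 2 * (Real.log κ ^ 2 * T1 d₀ d₁ n κ D * S2 d₀ d₁ n κ D)) := by
  -- thresholds for `k = log κ`
  set k₀ : ℝ := 3 + max k₁ 0 with hk₀
  have hk₀3 : 3 ≤ k₀ := by rw [hk₀]; have := le_max_right k₁ 0; linarith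
  have hk₀1 : k₁ ≤ k₀ := by rw [hk₀]; have := le_max_left k₁ 0; linarith
  refine ⟨Real.exp k₀, Real.exp_le_exp.mpr hk₀3, fun κ hκ => ?_⟩
  have hκpos : 0 < κ := lt_of_lt_of_le (Real.exp_pos _) hκ
  set k : ℝ := Real.log κ with hk
  have hk₀k : k₀ ≤ k := by rw [hk, ← Real.log_exp k₀]; exact Real.log_le_log (Real.exp_pos _) hκ
  have hk3 : 3 ≤ k := le_trans hk₀3 hk₀k
  have hkpos : 0 < k := by linarith
  have hκe : Real.exp 1 ≤ κ := le_trans (Real.exp_le_exp.mpr (by linarith)) hκ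
  have hκ1 : 1 < κ := lt_of_lt_of_le (by have := Real.exp_one_gt_d9; linarith) hκe
  have hkκ : k ≤ κ := by rw [hk]; exact le_trans (Real.log_le_sub_one_of_pos hκpos) (by linarith)
  refine ⟨le_trans hk₀1 hk₀k, ?_⟩
  set kk : ℝ := Real.log k with hkk
  have hkk1 : 1 ≤ kk := by
    rw [hkk]
    have h3 : Real.log 3 ≤ Real.log k := Real.log_le_log (by norm_num) hk3
    have he3 : 1 < Real.log 3 := by
      rw [← Real.log_exp 1]
      exact Real.log_lt_log (Real.exp_pos 1) (by have := Real.exp_one_lt_d9; linarith)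
    linarith
  -- thresholds for `L = log D`
  set c₂ : ℝ := (d₁ : ℝ) * (Real.log 2 + 2 * kk) + ((d₀ : ℝ) + d₁) * kk + ((n : ℝ) - d₀) * k with hc₂
  have hc₂nn : 0 ≤ c₂ := by
    have hd₀nR : (d₀ : ℝ) ≤ n := by exact_mod_cast hd₀n
    have hlog2 : 0 ≤ Real.log 2 := Real.log_nonneg (by norm_num)
    have t1 : 0 ≤ (d₁ : ℝ) * (Real.log 2 + 2 * kk) := mul_nonneg (Nat.cast_nonneg _) (by linarith)
    have t2 : 0 ≤ ((d₀ : ℝ) + d₁) * kk := mul_nonneg (by positivity) (by linarith)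
    have t3 : 0 ≤ ((n : ℝ) - d₀) * k := mul_nonneg (by linarith) (by linarith)
    rw [hc₂]; linarith
  set L₀ : ℝ := 3 + max (L₁ κ) 0 + κ + (c₂ + 3) + d₁ with hL₀
  have hL₀3 : 3 ≤ L₀ := by rw [hL₀]; have := le_max_right (L₁ κ) 0; linarith [hκpos.le, hc₂nn, (Nat.cast_nonneg d₁ : (0:ℝ) ≤ d₁)]
  have hL₀1 : L₁ κ ≤ L₀ := by rw [hL₀]; have := le_max_left (L₁ κ) 0; linarith [hκpos.le, hc₂nn, (Nat.cast_nonneg d₁ : (0:ℝ) ≤ d₁)]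
  have hL₀κ : κ ≤ L₀ := by rw [hL₀]; have := le_max_right (L₁ κ) 0; linarith [hc₂nn, (Nat.cast_nonneg d₁ : (0:ℝ) ≤ d₁)]
  have hL₀c : c₂ + 3 ≤ L₀ := by rw [hL₀]; have := le_max_right (L₁ κ) 0; linarith [hκpos.le, (Nat.cast_nonneg d₁ : (0:ℝ) ≤ d₁)]
  have hL₀d : (d₁ : ℝ) ≤ L₀ := by rw [hL₀]; have := le_max_right (L₁ κ) 0; linarith [hκpos.le, hc₂nn]
  set D₁ : ℕ := ⌈Real.exp L₀⌉₊ + ⌈16 * k ^ 2⌉₊ + 3 with hD₁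
  refine ⟨D₁, by rw [hD₁]; omega, fun D hD => ?_⟩
  have hDR : (D₁ : ℝ) ≤ D := by exact_mod_cast hD
  have hD₁R : (D₁ : ℝ) = (⌈Real.exp L₀⌉₊ : ℝ) + (⌈16 * k ^ 2⌉₊ : ℝ) + 3 := by rw [hD₁]; push_cast; ring
  have hceil1 : Real.exp L₀ ≤ (⌈Real.exp L₀⌉₊ : ℝ) := Nat.le_ceil _
  have hceil2 : 16 * k ^ 2 ≤ (⌈16 * k ^ 2⌉₊ : ℝ) := Nat.le_ceil _
  have hceil1nn : (0 : ℝ) ≤ (⌈Real.exp L₀⌉₊ : ℝ) := Nat.cast_nonneg _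
  have hceil2nn : (0 : ℝ) ≤ (⌈16 * k ^ 2⌉₊ : ℝ) := Nat.cast_nonneg _
  have hD₀exp : Real.exp L₀ ≤ D := by linarith
  have hD16 : 16 * k ^ 2 ≤ D := by linarith
  have hDpos : (0 : ℝ) < D := lt_of_lt_of_le (Real.exp_pos _) hD₀exp
  set L : ℝ := Real.log D with hLdef
  have hL₀L : L₀ ≤ L := by
    rw [hLdef, ← Real.log_exp L₀]; exact Real.log_le_log (Real.exp_pos _) hD₀exp
  have hL3 : 3 ≤ L := le_trans hL₀3 hL₀L
  have hLpos : 0 < L := by linarith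
  have hDe : Real.exp 1 ≤ (D : ℝ) := le_trans (Real.exp_le_exp.mpr (by linarith)) hD₀exp
  have hD1 : 1 < (D : ℝ) := lt_of_lt_of_le (by have := Real.exp_one_gt_d9; linarith) hDe
  refine ⟨le_trans hL₀1 hL₀L, le_trans hL₀κ hL₀L, hk3, hkκ, hL3, ?_, ?_, ?_⟩
  · -- `T₀`
    set x₀ : ℝ := κ * D / (Real.log κ * Real.log D) with hx₀
    have hx₀' : x₀ = κ * D / (k * L) := by rw [hx₀]
    have hx₀_ge : 2 ≤ x₀ := by
      rw [hx₀', le_div_iff₀ (by positivity)]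
      have hs : L ≤ 2 * Real.sqrt D := by
        have h1 : Real.log (Real.sqrt D) ≤ Real.sqrt D - 1 := Real.log_le_sub_one_of_pos (Real.sqrt_pos.mpr hDpos)
        have h2 : Real.log D = 2 * Real.log (Real.sqrt D) := by
          conv_lhs => rw [← Real.sq_sqrt hDpos.le]
          rw [Real.log_pow]; norm_num
        rw [hLdef, h2]; linarith
      have hsq : 4 * k ≤ Real.sqrt D := by
        rw [show (4 : ℝ) * k = Real.sqrt ((4 * k) ^ 2) by rw [Real.sqrt_sq (by positivity)]]
        exact Real.sqrt_le_sqrt (by nlinarith)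
      have hDD : Real.sqrt D * Real.sqrt D = (D : ℝ) := Real.mul_self_sqrt hDpos.le
      have hsD : 0 ≤ Real.sqrt (D : ℝ) := Real.sqrt_nonneg _
      have h1 : k * L ≤ k * (2 * Real.sqrt D) := mul_le_mul_of_nonneg_left hs hkpos.le
      have h2 : 4 * k * Real.sqrt D ≤ Real.sqrt D * Real.sqrt D := mul_le_mul_of_nonneg_right hsq hsD
      have h3 : 2 * (k * L) ≤ (D : ℝ) := by rw [← hDD]; linarith
      have h4 : (D : ℝ) ≤ κ * D := le_mul_of_one_le_left hDpos.le hκ1.le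
      linarith
    refine ⟨by rw [T0]; exact one_le_floor (by linarith), ?_, ?_⟩
    · rw [T0]; exact Nat.floor_le (by linarith)
    · rw [T0]
      have := Nat.sub_one_lt_floor x₀
      have hfl : x₀ / 2 ≤ (⌊x₀⌋₊ : ℝ) := by linarith
      have : κ * D / (Real.log κ * Real.log D) = x₀ := rfl
      rw [this]; linarith
  · -- `T₁`
    set θ : ℝ := Theta d₀ d₁ n κ D with hθ
    have hθpos : 0 < θ := Theta_pos hκ1 hD1
    set t₁ : ℝ := θ ^ (1 / (d₁ : ℝ)) with ht₁
    have ht₁pos : 0 < t₁ := Real.rpow_pos_of_pos hθpos _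
    set t : ℝ := Real.log t₁ with htdef
    have hd₁R : (0 : ℝ) < d₁ := by exact_mod_cast hd₁
    set LL : ℝ := Real.log L with hLL
    have hLL0 : 0 ≤ LL := Real.log_nonneg (by linarith)
    have hLLL : LL ≤ L := (Real.log_le_sub_one_of_pos (by linarith)).trans (by linarith)
    have ht_eq : (d₁ : ℝ) * t = ((d₀ : ℝ) + d₁) * kk + ((n : ℝ) - d₀) * k + (2 * (n : ℝ) - d₀) * L - ((n : ℝ) - d₀) * LL := by
      rw [htdef, ht₁, Real.log_rpow hθpos, hθ, log_Theta hκ1 hD1 hd₀n, ← hk, ← hLdef, ← hkk, ← hLL]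
      field_simp
    have hT1_le : (T1 d₀ d₁ n κ D : ℝ) ≤ t₁ := by rw [T1]; exact Nat.floor_le ht₁pos.le
    have hT1_lt : t₁ < (T1 d₀ d₁ n κ D : ℝ) + 1 := by rw [T1]; exact Nat.lt_floor_add_one _
    -- upper bound: `log 2 + 2kk + t ≤ L`
    have hd₀nR : (d₀ : ℝ) ≤ n := by exact_mod_cast hd₀n
    have hnd : (0 : ℝ) ≤ (n : ℝ) - d₀ := by linarith
    have ht_bound : Real.log 2 + 2 * kk + t ≤ L := by
      have h2n' : (2 * (n : ℝ) - d₀) ≤ (d₁ : ℝ) - 1 := by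
        have : 2 * n + 1 ≤ d₀ + d₁ := h2n
        have : (2 * (n : ℝ) + 1) ≤ (d₀ : ℝ) + d₁ := by exact_mod_cast this
        linarith
      have h1 : (d₁ : ℝ) * t ≤ ((d₀ : ℝ) + d₁) * kk + ((n : ℝ) - d₀) * k + ((d₁ : ℝ) - 1) * L := by
        rw [ht_eq]
        have p1 : (2 * (n : ℝ) - d₀) * L ≤ ((d₁ : ℝ) - 1) * L := mul_le_mul_of_nonneg_right h2n' hLpos.le
        have p2 : 0 ≤ ((n : ℝ) - d₀) * LL := mul_nonneg hnd hLL0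
        linarith
      have h2 : (d₁ : ℝ) * (Real.log 2 + 2 * kk + t) ≤ c₂ + ((d₁ : ℝ) - 1) * L := by rw [hc₂]; linarith
      have h3 : c₂ + ((d₁ : ℝ) - 1) * L ≤ (d₁ : ℝ) * L := by linarith [le_trans hL₀c hL₀L]
      exact le_of_mul_le_mul_left (h2.trans h3) hd₁R
    have h2k2t : 2 * k ^ 2 * t₁ ≤ D := by
      have h2 : 2 * (k ^ 2 * t₁) = Real.exp (Real.log 2 + 2 * kk + t) := by
        rw [Real.exp_add, Real.exp_add, Real.exp_log (by norm_num), htdef, Real.exp_log ht₁pos,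
          show (2 : ℝ) * kk = kk + kk by ring, Real.exp_add, hkk, Real.exp_log hkpos]; ring
      have h3 : Real.exp (Real.log 2 + 2 * kk + t) ≤ Real.exp L := Real.exp_le_exp.mpr ht_bound
      have h4 : Real.exp L = D := by rw [hLdef, Real.exp_log hDpos]
      linarith
    -- lower bound: `t ≥ L/d₁`, so `t₁ ≥ D^{1/d₁} ≥ 2`
    have ht_lower : L ≤ (d₁ : ℝ) * t := by
      rw [ht_eq]
      have hn1 : (1 : ℝ) ≤ n := by exact_mod_cast hn
      -- `(2n - d₀) L - (n - d₀) LL = nL + (n - d₀)(L - LL) ≥ n L ≥ L`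
      have p3 : 0 ≤ ((n : ℝ) - d₀) * (L - LL) := mul_nonneg hnd (sub_nonneg.mpr hLLL)
      have p4 : 0 ≤ ((d₀ : ℝ) + d₁) * kk := mul_nonneg (by positivity) (by linarith)
      have p5 : 0 ≤ ((n : ℝ) - d₀) * k := mul_nonneg hnd hkpos.le
      have p6 : 0 ≤ ((n : ℝ) - 1) * L := mul_nonneg (by linarith) hLpos.le
      linarith
    have hDpow : (D : ℝ) ^ (1 / (d₁ : ℝ)) ≤ t₁ := by
      have e1 : (D : ℝ) ^ (1 / (d₁ : ℝ)) = Real.exp (L / d₁) := by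
        rw [Real.rpow_def_of_pos hDpos, ← hLdef]; ring_nf
      have e2 : t₁ = Real.exp t := by rw [htdef, Real.exp_log ht₁pos]
      rw [e1, e2, Real.exp_le_exp, div_le_iff₀ hd₁R]
      linarith
    have ht₁2 : 2 ≤ t₁ := by
      refine le_trans ?_ hDpow
      have e1 : (D : ℝ) ^ (1 / (d₁ : ℝ)) = Real.exp (L / d₁) := by
        rw [Real.rpow_def_of_pos hDpos, ← hLdef]; ring_nf
      rw [e1]
      have : Real.log 2 ≤ L / d₁ := by
        rw [le_div_iff₀ hd₁R]
        have hl2 : Real.log 2 ≤ 1 := by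
          have := Real.log_lt_sub_one_of_pos (by norm_num : (0:ℝ) < 2) (by norm_num); linarith
        nlinarith [le_trans hL₀d hL₀L]
      have := Real.exp_le_exp.mpr this
      rwa [Real.exp_log (by norm_num)] at this
    have hT1_ge1 : 1 ≤ T1 d₀ d₁ n κ D := by rw [T1]; exact one_le_floor (by linarith)
    refine ⟨hT1_ge1, ?_, ?_, ?_, ?_⟩
    · -- `2k² T1 ≤ D`
      have : 2 * k ^ 2 * (T1 d₀ d₁ n κ D : ℝ) ≤ 2 * k ^ 2 * t₁ := by
        apply mul_le_mul_of_nonneg_left hT1_le; positivity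
      linarith
    · -- `D^{1/d₁} ≤ 2 T1`
      have := Nat.sub_one_lt_floor t₁
      rw [T1]
      have : θ ^ (1 / (d₁ : ℝ)) = t₁ := rfl
      rw [this]; linarith
    · -- `Θ ≤ (T1+1)^{d₁}`
      have e : θ = t₁ ^ d₁ := by
        rw [ht₁, ← Real.rpow_natCast, ← Real.rpow_mul hθpos.le, one_div_mul_cancel hd₁R.ne', Real.rpow_one]
      show θ ≤ _
      rw [e]
      exact pow_le_pow_left₀ ht₁pos.le hT1_lt.le _
    · have e : θ = t₁ ^ d₁ := by
        rw [ht₁, ← Real.rpow_natCast, ← Real.rpow_mul hθpos.le, one_div_mul_cancel hd₁R.ne', Real.rpow_one]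
      show _ ≤ θ
      rw [e]
      exact pow_le_pow_left₀ (Nat.cast_nonneg _) hT1_le _
  · -- `S₁, S₂`
    have hT1R : (1 : ℝ) ≤ T1 d₀ d₁ n κ D := by
      have h : 1 ≤ T1 d₀ d₁ n κ D := by
        -- `T1 ≥ 1`: `Θ ≥ 1`
        rw [T1]; apply one_le_floor
        have hlogθ : 0 ≤ Real.log (Theta d₀ d₁ n κ D) := log_Theta_nonneg hκe hDe hd₀n
        have hθpos : 0 < Theta d₀ d₁ n κ D := Theta_pos hκ1 hD1
        have : (1 : ℝ) ≤ Theta d₀ d₁ n κ D := by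
          have h1 : Real.exp 0 ≤ Real.exp (Real.log (Theta d₀ d₁ n κ D)) := Real.exp_le_exp.mpr hlogθ
          rwa [Real.exp_zero, Real.exp_log hθpos] at h1
        calc (1 : ℝ) = 1 ^ (1 / (d₁ : ℝ)) := by rw [Real.one_rpow]
          _ ≤ Theta d₀ d₁ n κ D ^ (1 / (d₁ : ℝ)) := Real.rpow_le_rpow (by norm_num) this (by positivity)
      exact_mod_cast h
    have hT1pos : (0 : ℝ) < T1 d₀ d₁ n κ D := by linarith
    -- `x₂ = D/(k² T1) ≥ 2` from `2k²T1 ≤ D` (second component above); re-derive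
    have h2k2T : 2 * k ^ 2 * (T1 d₀ d₁ n κ D : ℝ) ≤ D := by
      -- same as above: `T1 ≤ t₁`, `2k²t₁ ≤ D`
      have hθpos : 0 < Theta d₀ d₁ n κ D := Theta_pos hκ1 hD1
      set t₁ : ℝ := Theta d₀ d₁ n κ D ^ (1 / (d₁ : ℝ)) with ht₁
      have ht₁pos : 0 < t₁ := Real.rpow_pos_of_pos hθpos _
      have hT1_le : (T1 d₀ d₁ n κ D : ℝ) ≤ t₁ := by rw [T1]; exact Nat.floor_le ht₁pos.le
      set t : ℝ := Real.log t₁ with htdef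
      have hd₁R : (0 : ℝ) < d₁ := by exact_mod_cast hd₁
      set LL : ℝ := Real.log L with hLL
      have hLL0 : 0 ≤ LL := Real.log_nonneg (by linarith)
      have ht_eq : (d₁ : ℝ) * t = ((d₀ : ℝ) + d₁) * kk + ((n : ℝ) - d₀) * k + (2 * (n : ℝ) - d₀) * L - ((n : ℝ) - d₀) * LL := by
        rw [htdef, ht₁, Real.log_rpow hθpos, log_Theta hκ1 hD1 hd₀n, ← hk, ← hLdef, ← hkk, ← hLL]
        field_simp
      have hd₀nR : (d₀ : ℝ) ≤ n := by exact_mod_cast hd₀n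
      have hnd : (0 : ℝ) ≤ (n : ℝ) - d₀ := by linarith
      have ht_bound : Real.log 2 + 2 * kk + t ≤ L := by
        have h2n' : (2 * (n : ℝ) - d₀) ≤ (d₁ : ℝ) - 1 := by
          have : 2 * n + 1 ≤ d₀ + d₁ := h2n
          have : (2 * (n : ℝ) + 1) ≤ (d₀ : ℝ) + d₁ := by exact_mod_cast this
          linarith
        have h1 : (d₁ : ℝ) * t ≤ ((d₀ : ℝ) + d₁) * kk + ((n : ℝ) - d₀) * k + ((d₁ : ℝ) - 1) * L := by
          rw [ht_eq]
          nlinarith [mul_nonneg hnd hLL0, mul_le_mul_of_nonneg_right h2n' hLpos.le]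
        have h2 : (d₁ : ℝ) * (Real.log 2 + 2 * kk + t) ≤ c₂ + ((d₁ : ℝ) - 1) * L := by rw [hc₂]; linarith
        have h3 : c₂ + ((d₁ : ℝ) - 1) * L ≤ (d₁ : ℝ) * L := by linarith [le_trans hL₀c hL₀L]
        exact le_of_mul_le_mul_left (h2.trans h3) hd₁R
      have h2 : 2 * (k ^ 2 * t₁) = Real.exp (Real.log 2 + 2 * kk + t) := by
        rw [Real.exp_add, Real.exp_add, Real.exp_log (by norm_num), htdef, Real.exp_log ht₁pos,
          show (2 : ℝ) * kk = kk + kk by ring, Real.exp_add, hkk, Real.exp_log hkpos]; ring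
      have h3 : Real.exp (Real.log 2 + 2 * kk + t) ≤ Real.exp L := Real.exp_le_exp.mpr ht_bound
      have h4 : Real.exp L = D := by rw [hLdef, Real.exp_log hDpos]
      nlinarith [sq_nonneg k]
    set x₂ : ℝ := (D : ℝ) / (Real.log κ ^ 2 * T1 d₀ d₁ n κ D) with hx₂
    have hx₂_ge : 2 ≤ x₂ := by
      rw [hx₂, le_div_iff₀ (by positivity)]
      have e : Real.log κ = k := rfl
      rw [e]; linarith
    set x₁ : ℝ := κ * D / (Real.log κ ^ 2 * T1 d₀ d₁ n κ D) with hx₁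
    have hx₁x₂ : x₂ ≤ x₁ := by
      rw [hx₁, hx₂]
      apply div_le_div_of_nonneg_right _ (by positivity)
      exact le_mul_of_one_le_left hDpos.le hκ1.le
    have hx₁_ge : 2 ≤ x₁ := hx₂_ge.trans hx₁x₂
    refine ⟨by rw [S2]; exact one_le_floor (by linarith), by rw [S2, S1]; exact Nat.floor_le_floor hx₁x₂, ?_, ?_, ?_⟩
    · -- `k² T1 S1 ≤ κ D`
      have hS1 : (S1 d₀ d₁ n κ D : ℝ) ≤ x₁ := by rw [S1]; exact Nat.floor_le (by linarith)
      have e : Real.log κ = k := rfl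
      rw [hx₁, e, le_div_iff₀ (by positivity)] at hS1
      nlinarith
    · have hS2 : (S2 d₀ d₁ n κ D : ℝ) ≤ x₂ := by rw [S2]; exact Nat.floor_le (by linarith)
      have e : Real.log κ = k := rfl
      rw [hx₂, e, le_div_iff₀ (by positivity)] at hS2
      nlinarith
    · -- `D ≤ 2 k² T1 S2` as `S2 ≥ x₂/2`
      have := Nat.sub_one_lt_floor x₂
      have hfl : x₂ / 2 ≤ (S2 d₀ d₁ n κ D : ℝ) := by rw [S2]; linarith
      have e : Real.log κ = k := rfl
      rw [hx₂, e, div_div, div_le_iff₀ (by positivity)] at hfl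
      nlinarith


/-! ### The individual constraints ("plus ou moins immédiates"), in the regime of `param_bounds` -/

/-- **`U ≥ D max{T₀ log B₁, S₀ log B₂, ∑ Tᵢ log Aᵢ}`** with `B₁ = B₂ = D`, `log Aᵢ = κD/(T₁ log κ)`,
`U = κD²/(4c(12d+13))`: it suffices that `log κ ≥ 4c(12d+13)d₁`. [cite: RoyWaldschmidt1997ENS, proof of Théorème 5.1, p. 782] -/
theorem U_constraints {c d d₁ κ k L D T0 T1 : ℝ} (hc : 0 < c) (hd : 1 ≤ d) (hd₁ : 1 ≤ d₁) (hκ : 0 < κ)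
    (hk : 0 < k) (hL : 0 < L) (hD : 0 < D) (hT1 : 0 < T1)
    (hT0 : T0 ≤ κ * D / (k * L)) (hkbig : 4 * c * (12 * d + 13) * d₁ ≤ k) :
    D * (T0 * L) ≤ κ * D ^ 2 / (4 * c) / (12 * d + 13) ∧
    D * (T1 * (d₁ * (κ * D / (T1 * k)))) ≤ κ * D ^ 2 / (4 * c) / (12 * d + 13) := by
  have hk1 : 4 * c * (12 * d + 13) ≤ k := le_trans (le_mul_of_one_le_right (by positivity) hd₁) hkbig
  have hU : κ * D ^ 2 / (4 * c) / (12 * d + 13) = κ * D ^ 2 / (4 * c * (12 * d + 13)) := by rw [div_div]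
  constructor
  · calc D * (T0 * L) ≤ D * (κ * D / (k * L) * L) := by
          apply mul_le_mul_of_nonneg_left _ hD.le; exact mul_le_mul_of_nonneg_right hT0 hL.le
      _ = κ * D ^ 2 / k := by field_simp
      _ ≤ κ * D ^ 2 / (4 * c * (12 * d + 13)) := by
          apply div_le_div_of_nonneg_left (by positivity) (by positivity) hk1
      _ = _ := hU.symm
  · calc D * (T1 * (d₁ * (κ * D / (T1 * k)))) = d₁ * (κ * D ^ 2) / k := by field_simp
      _ ≤ d₁ * (κ * D ^ 2) / (4 * c * (12 * d + 13) * d₁) :=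
          div_le_div_of_nonneg_left (by positivity) (by positivity) hkbig
      _ = κ * D ^ 2 / (4 * c * (12 * d + 13)) := by field_simp
      _ = _ := hU.symm

/-- **`B₂ ≥ dS₀ + T₀ + d₁T₁`** with `B₂ = D`, `S₀ = T₀`: from `T₀ ≤ κD/(kL)`, `2k²T₁ ≤ D`, `L ≥ 2(d+1)κ`,
`k ≥ max{3, d₁}`. [cite: RoyWaldschmidt1997ENS, Théorème 2.1 p. 762; proof of Théorème 5.1 p. 782] -/
theorem B₂_constraint {d d₁ κ k L D T0 T1 : ℝ} (hd : 0 ≤ d) (hd₁ : 0 ≤ d₁) (hκ : 0 < κ) (hk : 3 ≤ k) (hkd : d₁ ≤ k)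
    (hL : 2 * (d + 1) * κ ≤ L) (hD : 0 < D)
    (hT0 : T0 ≤ κ * D / (k * L)) (hT1 : 2 * k ^ 2 * T1 ≤ D) :
    d * T0 + T0 + d₁ * T1 ≤ D := by
  have hL0 : 0 < L := lt_of_lt_of_le (by positivity) hL
  have hk0 : 0 < k := by linarith
  -- `(d+1) T0 ≤ (d+1) κ D/(k L) ≤ D/(2k) ≤ D/2`
  have h1 : (d + 1) * T0 ≤ D / 2 := by
    have h := mul_le_mul_of_nonneg_left hT0 (by positivity : (0:ℝ) ≤ d + 1)
    have h2 : (d + 1) * (κ * D / (k * L)) ≤ D / 2 := by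
      rw [mul_div_assoc', div_le_div_iff₀ (by positivity) (by positivity)]
      -- `(d+1) κ D * 2 ≤ D * (k L)`, from `2(d+1)κ ≤ L ≤ k L` (k ≥ 1)
      have : L ≤ k * L := le_mul_of_one_le_left hL0.le (by linarith)
      nlinarith
    linarith
  -- `d₁ T1 ≤ d₁ D/(2k²) ≤ D/2` as `d₁ ≤ k ≤ k²`
  have h2 : d₁ * T1 ≤ D / 2 := by
    have hT1' : T1 ≤ D / (2 * k ^ 2) := by rw [le_div_iff₀ (by positivity)]; linarith
    have hdk : d₁ ≤ k ^ 2 := le_trans hkd (by nlinarith)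
    calc d₁ * T1 ≤ d₁ * (D / (2 * k ^ 2)) := mul_le_mul_of_nonneg_left hT1' hd₁
      _ ≤ k ^ 2 * (D / (2 * k ^ 2)) := mul_le_mul_of_nonneg_right hdk (by positivity)
      _ = D / 2 := by field_simp
  linarith

/-- **`(1/8) exp(U/(2D)) ≥ binom(T₀+d₀, d₀)(T₁+1)^{d₁}`**: with `T₀ + d₀ ≤ D`, `T₁ + 1 ≤ D` the right side
is `≤ D^{d₀+d₁}`, and `(d₀+d₁) log D + log 8 ≤ U/(2D) = κD/(8c(12d+13))` once `D ≥ 8c(12d+13)(d+1) log D`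
(`κ ≥ 1`). [cite: RoyWaldschmidt1997ENS, Théorème 2.1 p. 762; proof of Théorème 5.1 p. 782] -/
theorem exp_constraint {c κ D : ℝ} {d₀ d₁ : ℕ} {T0 T1 : ℕ} (hc : 0 < c) (hκ : 1 ≤ κ) (hD : 3 ≤ Real.log D)
    (hD0 : 0 < D) (hT0 : (T0 : ℝ) + d₀ ≤ D) (hT1 : (T1 : ℝ) + 1 ≤ D)
    (hbig : 8 * c * (12 * ((d₀ : ℝ) + d₁) + 13) * (((d₀ : ℝ) + d₁) + 1) * Real.log D ≤ D) :
    (Nat.choose (T0 + d₀) d₀ : ℝ) * ((T1 : ℝ) + 1) ^ d₁ ≤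
      1 / 8 * Real.exp (κ * D ^ 2 / (4 * c) / (12 * ((d₀ : ℝ) + d₁) + 13) / (2 * D)) := by
  set L := Real.log D with hL
  have hDexp : Real.exp L = D := by rw [hL, Real.exp_log hD0]
  -- `LHS ≤ D^{d₀} D^{d₁} = exp((d₀+d₁) L)`
  have h1 : (Nat.choose (T0 + d₀) d₀ : ℝ) ≤ D ^ d₀ := by
    have := Nat.choose_le_pow (T0 + d₀) d₀
    calc (Nat.choose (T0 + d₀) d₀ : ℝ) ≤ ((T0 + d₀ : ℕ) : ℝ) ^ d₀ := by exact_mod_cast this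
      _ ≤ D ^ d₀ := by
          apply pow_le_pow_left₀ (by positivity)
          push_cast; exact hT0
  have h2 : ((T1 : ℝ) + 1) ^ d₁ ≤ D ^ d₁ := pow_le_pow_left₀ (by positivity) hT1 _
  have hpow : D ^ d₀ * D ^ d₁ = Real.exp (((d₀ : ℝ) + d₁) * L) := by
    calc D ^ d₀ * D ^ d₁ = D ^ (d₀ + d₁) := (pow_add _ _ _).symm
      _ = Real.exp L ^ (d₀ + d₁) := by rw [hDexp]
      _ = Real.exp (((d₀ + d₁ : ℕ) : ℝ) * L) := (Real.exp_nat_mul _ _).symm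
      _ = Real.exp (((d₀ : ℝ) + d₁) * L) := by push_cast; rfl
  have h3 : (Nat.choose (T0 + d₀) d₀ : ℝ) * ((T1 : ℝ) + 1) ^ d₁ ≤ Real.exp (((d₀ : ℝ) + d₁) * L) := by
    calc (Nat.choose (T0 + d₀) d₀ : ℝ) * ((T1 : ℝ) + 1) ^ d₁ ≤ D ^ d₀ * D ^ d₁ :=
          mul_le_mul h1 h2 (by positivity) (by positivity)
      _ = Real.exp (((d₀ : ℝ) + d₁) * L) := hpow
  -- exponent comparison
  have hexp : ((d₀ : ℝ) + d₁) * L + Real.log 8 ≤ κ * D ^ 2 / (4 * c) / (12 * ((d₀ : ℝ) + d₁) + 13) / (2 * D) := by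
    have e : κ * D ^ 2 / (4 * c) / (12 * ((d₀ : ℝ) + d₁) + 13) / (2 * D) = κ * D / (8 * c * (12 * ((d₀ : ℝ) + d₁) + 13)) := by
      field_simp; ring
    rw [e, le_div_iff₀ (by positivity)]
    have hlog8 : Real.log 8 ≤ 3 := by
      have : Real.log 8 ≤ 8 - 1 := Real.log_le_sub_one_of_pos (by norm_num)
      have h2 : Real.log 8 = 3 * Real.log 2 := by
        rw [show (8:ℝ) = 2 ^ 3 by norm_num, Real.log_pow]; norm_num
      have hl2 : Real.log 2 ≤ 1 := by
        have := Real.log_lt_sub_one_of_pos (by norm_num : (0:ℝ) < 2) (by norm_num); linarith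
      rw [h2]; linarith
    -- `((d₀+d₁) L + 3) · 8c(12d+13) ≤ 8c(12d+13)(d+1) L ≤ D ≤ κ D`
    have hd : (0:ℝ) ≤ (d₀ : ℝ) + d₁ := by positivity
    have h4 : (((d₀ : ℝ) + d₁) * L + 3) ≤ (((d₀ : ℝ) + d₁) + 1) * L := by nlinarith
    have h5 : D ≤ κ * D := le_mul_of_one_le_left hD0.le hκ
    set M : ℝ := 8 * c * (12 * ((d₀ : ℝ) + d₁) + 13) with hM
    have hMnn : 0 ≤ M := by positivity
    have s1 : (((d₀ : ℝ) + d₁) * L + Real.log 8) * M ≤ (((d₀ : ℝ) + d₁) * L + 3) * M :=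
      mul_le_mul_of_nonneg_right (by linarith) hMnn
    have s2 : (((d₀ : ℝ) + d₁) * L + 3) * M ≤ ((((d₀ : ℝ) + d₁) + 1) * L) * M := mul_le_mul_of_nonneg_right h4 hMnn
    have s3 : ((((d₀ : ℝ) + d₁) + 1) * L) * M = 8 * c * (12 * ((d₀ : ℝ) + d₁) + 13) * (((d₀ : ℝ) + d₁) + 1) * L := by
      rw [hM]; ring
    linarith
  calc (Nat.choose (T0 + d₀) d₀ : ℝ) * ((T1 : ℝ) + 1) ^ d₁ ≤ Real.exp (((d₀ : ℝ) + d₁) * L) := h3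
    _ = 1 / 8 * Real.exp (((d₀ : ℝ) + d₁) * L + Real.log 8) := by
        rw [Real.exp_add, Real.exp_log (by norm_num)]; ring
    _ ≤ 1 / 8 * Real.exp (κ * D ^ 2 / (4 * c) / (12 * ((d₀ : ℝ) + d₁) + 13) / (2 * D)) := by
        apply mul_le_mul_of_nonneg_left (Real.exp_le_exp.mpr hexp); norm_num

/-- **`binom(T₀+d₀, d₀)(T₁+1)^{d₁} ≥ 4(V/log E)ⁿ`**: `binom(T₀+d₀,d₀) ≥ (T₀+1)^{d₀}/d₀! ≥ (x₀/2)^{d₀}/d₀!`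
(`x₀ = κD/(kL)`), `(T₁+1)^{d₁} ≥ Θ`, so the left side is `≥ κⁿD^{2n}k^{d₁}/(2^{d₀}d₀! Lⁿ)` while
`4(V/L)ⁿ = 4κⁿD^{2n}/((4c)ⁿLⁿ)`: it suffices that `k^{d₁}(4c)ⁿ ≥ 4·2^{d₀}d₀!`.
[cite: RoyWaldschmidt1997ENS, Théorème 2.1 p. 762; proof of Théorème 5.1 p. 782] -/
theorem V_constraint {c κ D k L : ℝ} {d₀ d₁ n : ℕ} {T0 T1 : ℕ} (hc : 0 < c) (hκ : 0 < κ) (hD : 0 < D) (hk : 0 < k)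
    (hL : 0 < L) (hd₀n : d₀ ≤ n)
    (hT0 : κ * D / (k * L) ≤ 2 * T0)
    (hT1 : k ^ (d₀ + d₁) * κ ^ (n - d₀) * D ^ (2 * n - d₀) / L ^ (n - d₀) ≤ ((T1 : ℝ) + 1) ^ d₁)
    (hkbig : 4 * 2 ^ d₀ * (d₀.factorial : ℝ) ≤ k ^ d₁ * (4 * c) ^ n) :
    4 * (κ * D ^ 2 / (4 * c) / L) ^ n ≤ (Nat.choose (T0 + d₀) d₀ : ℝ) * ((T1 : ℝ) + 1) ^ d₁ := by
  have hchoose : ((T0 : ℝ) + 1) ^ d₀ / d₀.factorial ≤ (Nat.choose (T0 + d₀) d₀ : ℝ) := pow_div_factorial_le_choose T0 d₀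
  have hx : (κ * D / (k * L) / 2) ^ d₀ ≤ ((T0 : ℝ) + 1) ^ d₀ := by
    apply pow_le_pow_left₀ (by positivity); linarith
  -- the main product identity
  have h2n : d₀ ≤ 2 * n := by omega
  have key : (κ * D / (k * L) / 2) ^ d₀ * (k ^ (d₀ + d₁) * κ ^ (n - d₀) * D ^ (2 * n - d₀) / L ^ (n - d₀)) =
      κ ^ n * D ^ (2 * n) * k ^ d₁ / (2 ^ d₀ * L ^ n) := by
    have e1 : κ ^ n = κ ^ d₀ * κ ^ (n - d₀) := by rw [← pow_add, Nat.add_sub_cancel' hd₀n]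
    have e2 : D ^ (2 * n) = D ^ d₀ * D ^ (2 * n - d₀) := by rw [← pow_add, Nat.add_sub_cancel' h2n]
    have e3 : L ^ n = L ^ d₀ * L ^ (n - d₀) := by rw [← pow_add, Nat.add_sub_cancel' hd₀n]
    rw [e1, e2, e3, pow_add, div_pow, div_pow, mul_pow, mul_pow]
    field_simp
  calc 4 * (κ * D ^ 2 / (4 * c) / L) ^ n = 4 * (κ ^ n * D ^ (2 * n)) / ((4 * c) ^ n * L ^ n) := by
        rw [div_pow, div_pow, mul_pow, ← pow_mul]; field_simp
    _ ≤ κ ^ n * D ^ (2 * n) * k ^ d₁ / (2 ^ d₀ * L ^ n) / d₀.factorial := by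
        rw [div_div, div_le_div_iff₀ (by positivity) (by positivity)]
        -- `4 κⁿD²ⁿ (2^{d₀} Lⁿ d₀!) ≤ κⁿ D²ⁿ k^{d₁} ((4c)ⁿ Lⁿ)`
        have hP : 0 < κ ^ n * D ^ (2 * n) * L ^ n := by positivity
        nlinarith [mul_le_mul_of_nonneg_left hkbig hP.le]
    _ = (κ * D / (k * L) / 2) ^ d₀ / d₀.factorial *
          (k ^ (d₀ + d₁) * κ ^ (n - d₀) * D ^ (2 * n - d₀) / L ^ (n - d₀)) := by
        rw [← key]; ring
    _ ≤ ((T0 : ℝ) + 1) ^ d₀ / d₀.factorial * ((T1 : ℝ) + 1) ^ d₁ := by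
        apply mul_le_mul _ hT1 (by positivity) (by positivity)
        exact div_le_div_of_nonneg_right hx (by positivity)
    _ ≤ (Nat.choose (T0 + d₀) d₀ : ℝ) * ((T1 : ℝ) + 1) ^ d₁ :=
        mul_le_mul_of_nonneg_right hchoose (by positivity)

/-- **The height-side arithmetic** (p. 782): with `k²T₁S₁ ≤ κD`, `k²T₁S₂ ≤ D`, `2k²T₁ ≤ D`, `k ≤ κ`,
`Ca + Cℓ ≤ k`, `Cη ≤ k`: `S₁Ca + S₂Cℓκ ≤ log A`, `S₁Cη ≤ log A`, `2/D ≤ log A`, `1 ≤ log A` for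
`log A = κD/(T₁ log κ)`. [cite: RoyWaldschmidt1997ENS, proof of Théorème 5.1, pp. 782–783] -/
theorem logA_constraints {κ k D T1 S1 S2 Ca Cℓ Cη : ℝ} (hk : 3 ≤ k) (hkκ : k ≤ κ) (hD : 2 ≤ D) (hT1 : 1 ≤ T1)
    (hCa : 0 ≤ Ca) (hCℓ : 0 ≤ Cℓ) (hCη : 0 ≤ Cη)
    (hS1 : k ^ 2 * T1 * S1 ≤ κ * D) (hS2 : k ^ 2 * T1 * S2 ≤ D) (hT1D : 2 * k ^ 2 * T1 ≤ D)
    (hk1 : Ca + Cℓ ≤ k) (hk2 : Cη ≤ k) :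
    S1 * Ca + S2 * Cℓ * κ ≤ κ * D / (T1 * k) ∧ S1 * Cη ≤ κ * D / (T1 * k) ∧ 2 / D ≤ κ * D / (T1 * k) ∧
      1 ≤ κ * D / (T1 * k) := by
  have hk0 : 0 < k := by linarith
  have hκ0 : 0 < κ := by linarith
  have hD0 : 0 < D := by linarith
  have hT10 : 0 < T1 := by linarith
  have hS1' : S1 ≤ κ * D / (k ^ 2 * T1) := by rw [le_div_iff₀ (by positivity)]; linarith
  have hS2' : S2 ≤ D / (k ^ 2 * T1) := by rw [le_div_iff₀ (by positivity)]; linarith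
  refine ⟨?_, ?_, ?_, ?_⟩
  · calc S1 * Ca + S2 * Cℓ * κ ≤ κ * D / (k ^ 2 * T1) * Ca + D / (k ^ 2 * T1) * Cℓ * κ := by
          gcongr
      _ = (Ca + Cℓ) * (κ * D / (k ^ 2 * T1)) := by ring
      _ ≤ k * (κ * D / (k ^ 2 * T1)) := mul_le_mul_of_nonneg_right hk1 (by positivity)
      _ = κ * D / (T1 * k) := by field_simp
  · calc S1 * Cη ≤ κ * D / (k ^ 2 * T1) * Cη := mul_le_mul_of_nonneg_right hS1' hCη
      _ ≤ κ * D / (k ^ 2 * T1) * k := mul_le_mul_of_nonneg_left hk2 (by positivity)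
      _ = κ * D / (T1 * k) := by field_simp
  · -- `2/D ≤ 1 ≤ κ/k ≤ κD/(T1 k)` (T1 ≤ D)
    have hk2 : (1 : ℝ) ≤ 2 * k ^ 2 := by nlinarith
    have hT1D' : T1 ≤ D := le_trans (by have := mul_le_mul_of_nonneg_right hk2 hT10.le; linarith) hT1D
    rw [div_le_div_iff₀ hD0 (by positivity)]
    have p1 : T1 * k ≤ D * κ := mul_le_mul hT1D' hkκ hk0.le hD0.le
    have p2 : 2 * (D * κ) ≤ D * (D * κ) := mul_le_mul_of_nonneg_right hD (by positivity)
    nlinarith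
  · rw [le_div_iff₀ (by positivity)]
    have hk2 : (1 : ℝ) ≤ 2 * k ^ 2 := by nlinarith
    have hT1D' : T1 ≤ D := le_trans (by have := mul_le_mul_of_nonneg_right hk2 hT10.le; linarith) hT1D
    have p1 : T1 * k ≤ D * κ := mul_le_mul hT1D' hkκ hk0.le hD0.le
    linarith

/-- **The additive height constraint** `log(∑ Sₘ) + κ ≤ log D` (p. 782, using `T₁ > D^{1/(2d₁)}`-type
lower bounds): with `∑ Sₘ ≤ CℓS₁`, `k²T₁S₁ ≤ κD`, `D^{1/d₁} ≤ 2T₁`, it suffices that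
`d₁(log(2Cℓκ) + κ) ≤ log D`. [cite: RoyWaldschmidt1997ENS, proof of Théorème 5.1, p. 782] -/
theorem additive_height_constraint {κ k D T1 S1 Cℓ : ℝ} {d₁ : ℕ} (hd₁ : 0 < d₁) (hκ : 1 ≤ κ) (hk : 1 ≤ k)
    (hD : 1 < D) (hT1 : 0 < T1) (hS10 : 0 < S1) (hCℓ : 1 ≤ Cℓ)
    (hS1 : k ^ 2 * T1 * S1 ≤ κ * D) (hDT1 : D ^ (1 / (d₁ : ℝ)) ≤ 2 * T1)
    (hbig : (d₁ : ℝ) * (Real.log (2 * Cℓ * κ) + κ) ≤ Real.log D) :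
    Real.log (Cℓ * S1) + κ ≤ Real.log D := by
  have hD0 : 0 < D := by linarith
  have hd₁R : (0 : ℝ) < d₁ := by exact_mod_cast hd₁
  set L := Real.log D with hL
  -- `S1 ≤ κ D/(k² T1) ≤ 2κ D / (k² D^{1/d₁}) ≤ 2 κ D^{1 - 1/d₁}`
  have hpow_pos : 0 < D ^ (1 / (d₁ : ℝ)) := Real.rpow_pos_of_pos hD0 _
  have hS1' : S1 ≤ 2 * κ * D / D ^ (1 / (d₁ : ℝ)) := by
    rw [le_div_iff₀ hpow_pos]
    have h1 : S1 * D ^ (1 / (d₁ : ℝ)) ≤ S1 * (2 * T1) := mul_le_mul_of_nonneg_left hDT1 hS10.le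
    have h2 : S1 * (2 * T1) ≤ 2 * κ * D := by
      have : T1 * S1 ≤ κ * D := by
        have hk2 : 1 ≤ k ^ 2 := by nlinarith
        nlinarith [mul_le_mul_of_nonneg_right hk2 (by positivity : (0:ℝ) ≤ T1 * S1)]
      nlinarith
    linarith
  have hDpow : 2 * κ * D / D ^ (1 / (d₁ : ℝ)) = 2 * κ * D ^ (1 - 1 / (d₁ : ℝ)) := by
    rw [Real.rpow_sub hD0, Real.rpow_one]; ring
  rw [hDpow] at hS1'
  have hlog : Real.log (Cℓ * S1) ≤ Real.log (2 * Cℓ * κ) + (1 - 1 / (d₁ : ℝ)) * L := by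
    have h1 : Cℓ * S1 ≤ (2 * Cℓ * κ) * D ^ (1 - 1 / (d₁ : ℝ)) := by
      have := mul_le_mul_of_nonneg_left hS1' (by linarith : (0:ℝ) ≤ Cℓ); linarith [this]
    have h2 := Real.log_le_log (by positivity) h1
    have h3 : Real.log ((2 * Cℓ * κ) * D ^ (1 - 1 / (d₁ : ℝ))) = Real.log (2 * Cℓ * κ) + (1 - 1 / (d₁ : ℝ)) * L := by
      rw [Real.log_mul (by positivity) (ne_of_gt (Real.rpow_pos_of_pos hD0 _)), Real.log_rpow hD0]
    rw [h3] at h2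
    exact h2
  -- conclude
  have hkey : Real.log (2 * Cℓ * κ) + κ ≤ L / d₁ := by
    rw [le_div_iff₀ hd₁R]; linarith
  have e : (1 - 1 / (d₁ : ℝ)) * L = L - L / d₁ := by field_simp
  linarith

/-- **The approximation constraints**: with `V = κD²/(4c)`, `exp(-c⁻¹κD²) ≤ exp(-V)`;
`M exp(-c⁻¹κD²) ≤ exp(-V)` as soon as `M ≤ 3κD²/(4c)`; and `exp(-c⁻¹κD²) ≤ cmin` as soon as
`-log cmin ≤ κD²/c`. [cite: RoyWaldschmidt1997ENS, proof of Théorème 5.1, pp. 781–782] -/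
theorem approx_constraints {c κ D M cmin : ℝ} (hc : 0 < c) (hκ : 0 < κ) (hD : 0 < D) (hM : 0 < M) (hcmin : 0 < cmin)
    (hM' : M ≤ 3 * κ * D ^ 2 / (4 * c)) (hlog : -Real.log cmin ≤ κ * D ^ 2 / c) :
    Real.exp (-(κ * D ^ 2 / c)) ≤ Real.exp (-(κ * D ^ 2 / (4 * c))) ∧
    M * Real.exp (-(κ * D ^ 2 / c)) ≤ Real.exp (-(κ * D ^ 2 / (4 * c))) ∧
    Real.exp (-(κ * D ^ 2 / c)) ≤ cmin := by
  have hV : κ * D ^ 2 / (4 * c) ≤ κ * D ^ 2 / c := by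
    apply div_le_div_of_nonneg_left (by positivity) hc; linarith
  refine ⟨Real.exp_le_exp.mpr (by linarith), ?_, ?_⟩
  · have hlogM : Real.log M ≤ 3 * κ * D ^ 2 / (4 * c) := le_trans (Real.log_le_self hM.le) hM'
    calc M * Real.exp (-(κ * D ^ 2 / c)) = Real.exp (Real.log M + -(κ * D ^ 2 / c)) := by
          rw [Real.exp_add, Real.exp_log hM]
      _ ≤ Real.exp (-(κ * D ^ 2 / (4 * c))) := by
          apply Real.exp_le_exp.mpr
          have e : κ * D ^ 2 / (4 * c) = κ * D ^ 2 / c - 3 * κ * D ^ 2 / (4 * c) := by field_simp; ring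
          linarith
  · calc Real.exp (-(κ * D ^ 2 / c)) ≤ Real.exp (Real.log cmin) := Real.exp_le_exp.mpr (by linarith)
      _ = cmin := Real.exp_log hcmin

/-- **The constraint of Théorème 4.1** `D > 2d₁ ∑ Tᵢ log A'ᵢ` with `log A'ᵢ = max{1, S_{ℓ₁} H}`,
`T₁S_{ℓ₁} ≤ D/k²`, `2k²T₁ ≤ D`: it suffices that `k² > 2d₁²(1 + H)`.
[cite: RoyWaldschmidt1997ENS, Théorème 4.1 p. 772; proof of Théorème 5.1 p. 783] -/
theorem thm41_constraint {k D T1 S2 H : ℝ} {d₁ : ℕ} (hk : 0 < k) (hD : 0 < D) (hH : 0 ≤ H)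
    (hTS : k ^ 2 * T1 * S2 ≤ D) (hT1D : 2 * k ^ 2 * T1 ≤ D) (hkbig : 2 * (d₁ : ℝ) ^ 2 * (1 + H) < k ^ 2) :
    2 * (d₁ : ℝ) * (T1 * ((d₁ : ℝ) * max 1 (S2 * H))) < D := by
  have hmax : T1 * max 1 (S2 * H) ≤ (1 + H) * D / k ^ 2 := by
    rw [le_div_iff₀ (by positivity)]
    rcases le_total 1 (S2 * H) with h | h
    · rw [max_eq_right h]
      nlinarith [mul_le_mul_of_nonneg_right hTS hH]
    · rw [max_eq_left h]
      nlinarith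
  have hd : (0:ℝ) ≤ (d₁ : ℝ) ^ 2 := by positivity
  calc 2 * (d₁ : ℝ) * (T1 * ((d₁ : ℝ) * max 1 (S2 * H))) = 2 * (d₁ : ℝ) ^ 2 * (T1 * max 1 (S2 * H)) := by ring
    _ ≤ 2 * (d₁ : ℝ) ^ 2 * ((1 + H) * D / k ^ 2) := mul_le_mul_of_nonneg_left hmax (by positivity)
    _ = (2 * (d₁ : ℝ) ^ 2 * (1 + H)) / k ^ 2 * D := by ring
    _ < 1 * D := by
        apply mul_lt_mul_of_pos_right _ hD
        rw [div_lt_one (by positivity)]; exact hkbig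
    _ = D := one_mul D

end Sec5

end RoyWaldschmidt1997

end Literature.NumberTheory.Transcendental
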